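import Mathlib
import Literature.MathematicalPhysics.QuantumLattice.HubbardRingPerronFrobeniusProofs
import Literature.MathematicalPhysics.QuantumLattice.FreeFermiGasNoPairFieldLRO
import Literature.MathematicalPhysics.QuantumLattice.GriffithsLemmaGroundStates
import Literature.MathematicalPhysics.QuantumLattice.HubbardKleinBottleFlux
import HarnessLib

/-!
# Regularity of the glued / decoupled Hubbard tube Hamiltonians (tool S4 of line `seam_flow`)

Route `SeamInduction`, crux `SeamGluingLocality` (stmt-HubbardSuperconductivity-18509), line
`seam_flow` (crux workfile `Cruxes/SeamGluingLocality/Lines/seam_flow.lean`), tool stub S4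
`StubRegularity`, plus the generic facts every line on these tubes consumes.

Objects (the crux's verbatim let-prefix, extended by the line's two lets): on a carrier
`Λ ≃ ℤ/L × ℤ/M`, `H0` is the Hubbard Hamiltonian (`hamiltonian G 1 U` of HubbardWave0) of the
tube graph, `Hs` the Hubbard Hamiltonian of the TWO-TUBE graph (rows `0 … M′-1` and `M′ … M-1`
each closed periodically), `Tw θ` the seam-column twist
`Σ_{b,σ} (1 - e^{iθ}) c†_{(0,b)σ} c_{(-1,b)σ} + (1 - e^{-iθ}) c†_{(-1,b)σ} c_{(0,b)σ}`, and
`szSector N 0` the joint `(N, S^z = 0)` sector.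

## Generic part (any finite `Λ`)
* `preservesSectors_sub` — `PreservesSectors` is closed under subtraction;
* `preservesSectors_mulVec_mem_szSector` — a matrix conserving `N↑`, `N↓` maps every joint sector
  `szSector N S` into itself (via `commute_diagonal` and `mulVec_mem_szSector_of_commute`);
* `isHermitian_twistSum`, `preservesSectors_twistSum` — the seam-column twist (for ANY orbital
  maps `p q`) is Hermitian (`star (1 - e^{iθ}) = 1 - e^{-iθ}`, `(c† c)ᴴ = c† c` reversed) and
  conserves `N↑`, `N↓`;
* `exists_unit_ground_szSector` — for a Hermitian, sector-preserving `H` and `m ≤ |Λ|` there is a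
  UNIT vector of `szSector (2m) 0` realising `minEnergyOn H (szSector (2m) 0)` (the witness form in
  which the seam-flow comparison `seamFlow_comparison` and the pencil lemmas of
  `GriffithsLemmaGroundStates` take their ground states) — `sector_groundState` on the coordinate
  sector `mem_szSector_two_mul_zero_iff`, normalised;
* `szSector_two_mul_zero_ne_bot` — that sector is non-zero (`|α₀↑ α₀↓⟩`).

## The stub
`seamFlow_regularity` is literally the body of `SeamFlow.StubRegularity`: for all sizes, carriers,
split widths `M′`, couplings, twists and `N`, `Hs + Tw θ` and `H0 - Hs` are Hermitian and leave
`szSector N 0` invariant, and the nominal sector `szSector (2⌊(1-δ)LM/2⌋) 0` is `≠ ⊥` for every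
`δ ∈ (0, 3/10)` (`⌊(1-δ)LM/2⌋ ≤ LM = |Λ|`). `seamFlow_exists_unit_ground_pencil`: the seam-flow
pencil `Hs + Tw θ + t·(H0 - Hs)` has unit sector ground states in the nominal sector at every
partial coupling `t` (existence half of the witnesses of `StubSeamTwistResponse`).

Sources: Lieb, PRL 62 (1989) 1201 (block structure in `(N↑, N↓)`); Tasaki (2020) §2.2, §9.3;
Scalapino–White–Zhang, PRB 47 (1993) 7995 §II (twisted boundary hopping is Hermitian). Folklore;
no definition is introduced; no route file is imported.

## Tree search
REUSED: `LiebThm1.hamiltonian_isHermitian`, `LiebThm1.preservesSectors_hamiltonian`,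
`LiebThm1.preservesSectors_hopping`, `PreservesSectors.{add,smul,sum,commute_diagonal}`,
`LiebThm1.totalNumber_eq_diagonal`, `LiebThm1.spinZ_eq_diagonal`, `mulVec_mem_szSector_of_commute`
(FreeFermiGasNoPairFieldLRO), `mem_szSector_two_mul_zero_iff`, `sector_groundState`,
`exists_smul_unit`, `re_rayleigh_of_eigen_minEnergyOn` (GriffithsLemmaGroundStates),
`star_one_sub_exp_I_mul` (HubbardKleinBottleFlux). The
torus-specific versions (`isHermitian_seamTwist`, `preservesSectors_seamTwist`, HubbardTorusFlux)
are stated for `FermionTorus 2 L` only; here the carrier and the orbital maps are arbitrary.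
-/

noncomputable section

set_option linter.dupNamespace false -- `Summit.<S>.<S>` doubles the summit name (tree convention)

namespace Summit.HubbardSuperconductivity.HubbardSuperconductivity.Theorems

open scoped BigOperators Topology Manifold Classical MeasureTheory ProbabilityTheory Matrix InnerProductSpace ComplexConjugate ContinuousMap
open Filter Set Function TopologicalSpace MeasureTheory
open Matrix Finset
open Literature.MathematicalPhysics.QuantumLattice

section Generic

variable {Λ : Type*} [LinearOrder Λ] [Fintype Λ]

/-- `PreservesSectors` (conservation of `N↑` and `N↓`, entrywise) is closed under subtraction.
[folklore] -/
theorem preservesSectors_sub {A B : Matrix (Finset (Orb Λ)) (Finset (Orb Λ)) ℂ}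
    (hA : PreservesSectors A) (hB : PreservesSectors B) : PreservesSectors (A - B) := by
  intro s s' h
  by_cases h0 : A s s' = 0
  · have h1 : B s s' ≠ 0 := by
      intro hb
      apply h
      rw [Matrix.sub_apply, h0, hb, sub_zero]
    exact hB s s' h1
  · exact hA s s' h0

/-- A matrix conserving `N↑` and `N↓` maps every joint sector `szSector N S` into itself: it
commutes with the diagonal operators `N` and `S^z` (`PreservesSectors.commute_diagonal`), hence
preserves their joint eigenspaces. Lieb, PRL 62 (1989) 1201. [folklore] -/
theorem preservesSectors_mulVec_mem_szSector {A : Matrix (Finset (Orb Λ)) (Finset (Orb Λ)) ℂ}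
    (hA : PreservesSectors A) {N : ℕ} {S : ℝ} {v : Fock (Orb Λ)} (hv : v ∈ szSector N S) :
    A *ᵥ v ∈ szSector N S := by
  have hN : Commute A totalNumber := by
    rw [LiebThm1.totalNumber_eq_diagonal]
    exact hA.commute_diagonal fun a b => ((a + b : ℕ) : ℂ)
  have hS : Commute A HubbardWave0.spinZ := by
    rw [LiebThm1.spinZ_eq_diagonal]
    exact hA.commute_diagonal fun a b => (1 / 2 : ℂ) * ((a : ℂ) - (b : ℂ))
  exact mulVec_mem_szSector_of_commute hN hS hv

/-- One seam bond with both orientations, `c · c†_p c_q + (star c) · c†_q c_p`, is Hermitian.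
Scalapino–White–Zhang (1993) §II. [folklore] -/
theorem isHermitian_twistTerm (p q : Orb Λ) (c : ℂ) :
    (c • (creation p * annihilation q) + star c • (creation q * annihilation p) :
      Matrix (Finset (Orb Λ)) (Finset (Orb Λ)) ℂ).IsHermitian := by
  have hc : ∀ i : Orb Λ, (creation i : Matrix (Finset (Orb Λ)) (Finset (Orb Λ)) ℂ)ᴴ =
      annihilation i := fun i => conjTranspose_conjTranspose _
  have ha : ∀ i : Orb Λ, (annihilation i : Matrix (Finset (Orb Λ)) (Finset (Orb Λ)) ℂ)ᴴ =
      creation i := fun i => rfl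
  unfold Matrix.IsHermitian
  rw [conjTranspose_add, conjTranspose_smul, conjTranspose_smul, conjTranspose_mul,
    conjTranspose_mul, star_star, ha, hc, ha, hc, add_comm]

/-- **The seam-column twist is Hermitian**, for arbitrary orbital maps `p q` (in the line:
`p b σ = (0,b)σ`, `q b σ = (-1,b)σ` along a labelling `e`):
`Σ_{b,σ} (1 - e^{iθ}) c†_{p} c_{q} + (1 - e^{-iθ}) c†_{q} c_{p}`. Scalapino–White–Zhang, PRB 47
(1993) 7995 §II. [folklore] -/
theorem isHermitian_twistSum {ι κ : Type*} [Fintype ι] [Fintype κ] (p q : ι → κ → Orb Λ) (θ : ℝ) :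
    (∑ b : ι, ∑ σ : κ, ((1 - Complex.exp (Complex.I * θ)) •
        (creation (p b σ) * annihilation (q b σ)) +
      (1 - Complex.exp (-(Complex.I * θ))) • (creation (q b σ) * annihilation (p b σ))) :
      Matrix (Finset (Orb Λ)) (Finset (Orb Λ)) ℂ).IsHermitian := by
  unfold Matrix.IsHermitian
  simp only [conjTranspose_sum]
  refine Finset.sum_congr rfl fun b _ => Finset.sum_congr rfl fun σ _ => ?_
  have h := isHermitian_twistTerm (p b σ) (q b σ) (1 - Complex.exp (Complex.I * θ))
  rw [star_one_sub_exp_I_mul] at h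
  exact h

/-- **The seam-column twist conserves `N↑` and `N↓`** (it is a sum of spin-diagonal hoppings),
for arbitrary site maps. [folklore] -/
theorem preservesSectors_twistSum {ι κ : Type*} [Fintype ι] [Fintype κ] (x y : ι → κ → Λ)
    (s : ι → κ → Fin 2) (c d : ℂ) :
    PreservesSectors (∑ b : ι, ∑ σ : κ, (c • (creation (orb (x b σ) (s b σ)) *
        annihilation (orb (y b σ) (s b σ))) +
      d • (creation (orb (y b σ) (s b σ)) * annihilation (orb (x b σ) (s b σ)))) :
      Matrix (Finset (Orb Λ)) (Finset (Orb Λ)) ℂ) :=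
  PreservesSectors.sum fun _ _ => PreservesSectors.sum fun _ _ =>
    ((LiebThm1.preservesSectors_hopping _ _ _).smul c).add
      ((LiebThm1.preservesSectors_hopping _ _ _).smul d)

/-- **Unit sector ground states exist.** For a Hermitian matrix `H` conserving `N↑`, `N↓` and
`m ≤ |Λ|` there is a unit vector `φ ∈ szSector (2m) 0` with
`re ⟨φ, H φ⟩ = minEnergyOn H (szSector (2m) 0)` — the witness form consumed by the seam-flow
comparison and the pencil lemmas. (`sector_groundState` on the coordinate sector
`mem_szSector_two_mul_zero_iff`, then normalise the eigenvector.) Tasaki (2020) §2.2; Lieb, PRL 62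
(1989) 1201, proof of Thm 1. [folklore] -/
theorem exists_unit_ground_szSector {H : Matrix (Finset (Orb Λ)) (Finset (Orb Λ)) ℂ}
    (hH : H.IsHermitian) (hP : PreservesSectors H) {m : ℕ} (hm : m ≤ Fintype.card Λ) :
    ∃ φ : Fock (Orb Λ), φ ∈ szSector (2 * m) 0 ∧ star φ ⬝ᵥ φ = 1 ∧
      (star φ ⬝ᵥ H *ᵥ φ).re = H.minEnergyOn (szSector (2 * m) 0) := by
  obtain ⟨α₀, -, hα₀⟩ : ∃ α₀ : Finset Λ, α₀ ⊆ univ ∧ α₀.card = m :=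
    Finset.exists_subset_card_eq (by rwa [Finset.card_univ])
  have hp : ∃ s : Finset (Orb Λ), (upPart s).card = m ∧ (downPart s).card = m :=
    ⟨pairSet α₀ α₀, by rw [upPart_pairSet, hα₀], by rw [downPart_pairSet, hα₀]⟩
  have hinv : ∀ s s' : Finset (Orb Λ), ¬((upPart s).card = m ∧ (downPart s).card = m) →
      ((upPart s').card = m ∧ (downPart s').card = m) → H s s' = 0 := by
    intro s s' hs hs'
    by_contra h
    have := hP s s' h
    exact hs ⟨this.1.trans hs'.1, this.2.trans hs'.2⟩
  have hK : ∀ v : Fock (Orb Λ), v ∈ szSector (2 * m) (0 : ℝ) ↔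
      ∀ s, ¬((upPart s).card = m ∧ (downPart s).card = m) → v s = 0 :=
    fun v => mem_szSector_two_mul_zero_iff m v
  obtain ⟨⟨v, hv, hv0, hHv⟩, -⟩ := sector_groundState H hH
    (fun s => (upPart s).card = m ∧ (downPart s).card = m) hp hinv (szSector (2 * m) 0) hK
  obtain ⟨c, -, hc1⟩ := exists_smul_unit hv0
  refine ⟨c • v, Submodule.smul_mem _ c hv, hc1, ?_⟩
  refine re_rayleigh_of_eigen_minEnergyOn H _ hc1 ?_
  rw [mulVec_smul, hHv, smul_comm]

/-- The joint sector `(2m, 0)` is non-zero for `m ≤ |Λ|`: it contains the occupation basis state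
`|α₀↑ α₀↓⟩` with `|α₀| = m`. [folklore] -/
theorem szSector_two_mul_zero_ne_bot {m : ℕ} (hm : m ≤ Fintype.card Λ) :
    (szSector (2 * m) 0 : Submodule ℂ (Fock (Orb Λ))) ≠ ⊥ := by
  obtain ⟨α₀, -, hα₀⟩ : ∃ α₀ : Finset Λ, α₀ ⊆ univ ∧ α₀.card = m :=
    Finset.exists_subset_card_eq (by rwa [Finset.card_univ])
  rw [Submodule.ne_bot_iff]
  refine ⟨Pi.single (pairSet α₀ α₀) 1, ?_, ?_⟩
  · rw [mem_szSector_two_mul_zero_iff]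
    intro s hs
    by_cases hs0 : s = pairSet α₀ α₀
    · subst hs0
      exact absurd ⟨by rw [upPart_pairSet, hα₀], by rw [downPart_pairSet, hα₀]⟩ hs
    · exact Pi.single_eq_of_ne hs0 _
  · intro h
    have := congrFun h (pairSet α₀ α₀)
    simp at this

omit [LinearOrder Λ] in
/-- Size of a carrier labelled by `ℤ/L × ℤ/M`: `|Λ| = L·M`. [folklore] -/
theorem card_eq_of_equiv_zmod_prod {L M : ℕ} [NeZero L] [NeZero M] (e : Λ ≃ ZMod L × ZMod M) :
    Fintype.card Λ = L * M := by
  rw [Fintype.card_congr e, Fintype.card_prod, ZMod.card, ZMod.card]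

omit [LinearOrder Λ] [Fintype Λ] in
/-- The nominal filling fits: `⌊(1-δ)·(L·M)/2⌋ ≤ L·M` for `0 ≤ δ ≤ 1`. [folklore] -/
theorem floor_filling_le {L M : ℕ} {δ : ℝ} (h0 : 0 ≤ δ) (h1 : δ ≤ 1) :
    ⌊(1 - δ) * ((L : ℝ) * (M : ℝ)) / 2⌋₊ ≤ L * M := by
  have hLM : (0 : ℝ) ≤ (L : ℝ) * (M : ℝ) := by positivity
  have hx0 : 0 ≤ (1 - δ) * ((L : ℝ) * (M : ℝ)) / 2 := by
    have : 0 ≤ 1 - δ := by linarith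
    positivity
  have hle : (1 - δ) * ((L : ℝ) * (M : ℝ)) / 2 ≤ (L * M : ℕ) := by
    push_cast
    nlinarith
  exact_mod_cast (Nat.floor_le hx0).trans hle

omit [LinearOrder Λ] [Fintype Λ] in
/-- The seam-flow pencil `B + T + t·(A - B)` of Hermitian matrices with a REAL coupling `t` is
Hermitian. [folklore] -/
theorem isHermitian_seamPencil {n : Type*} {A B T : Matrix n n ℂ} (hA : A.IsHermitian)
    (hB : B.IsHermitian) (hT : T.IsHermitian) (t : ℝ) :
    (B + T + (t : ℂ) • (A - B)).IsHermitian := by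
  refine (hB.add hT).add ?_
  rw [Matrix.IsHermitian, conjTranspose_smul, (hA.sub hB).eq, Complex.star_def, Complex.conj_ofReal]

end Generic

/-- **Tool S4 of line `seam_flow` (regularity): the body of `SeamFlow.StubRegularity` with its four
unused lets (`E`, `stiff`, `icomp`, `Es`) dropped — definitionally the same statement.**
For all sizes `L, M`, carriers `Λ ≃ ℤ/L × ℤ/M`, split widths `M′`, couplings `U`, twists `θ` and
particle numbers `N`: the twisted two-tube Hamiltonian `Hs + Tw θ` and the seam operator `H0 - Hs`
are Hermitian and leave the joint sector `(N, S^z = 0)` invariant (sums of spin-diagonal hoppings,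
their adjoints and `n↑n↓` terms), and the nominal sector `(2⌊(1-δ)LM/2⌋, 0)` is non-zero for
every `δ ∈ (0, 3/10)` (`⌊(1-δ)LM/2⌋ ≤ LM = |Λ|`). Lieb, PRL 62 (1989) 1201; Tasaki (2020) §2.2,
§9.3. [folklore] -/
theorem seamFlow_regularity :
    open Matrix Literature.MathematicalPhysics.QuantumLattice in let H0 : ∀ (L M : ℕ) (Λ : Type) [LinearOrder Λ] [Fintype Λ], (Λ ≃ ZMod L × ZMod M) → ℝ → Matrix (Finset (Orb Λ)) (Finset (Orb Λ)) ℂ := fun _ _ Λ _ _ e U => hamiltonian (SimpleGraph.fromRel fun x y : Λ => y = e.symm ((e x).1 + 1, (e x).2) ∨ y = e.symm ((e x).1, (e x).2 + 1)) 1 U; let Tw : ∀ (L M : ℕ) [NeZero L] [NeZero M] (Λ : Type) [LinearOrder Λ] [Fintype Λ], (Λ ≃ ZMod L × ZMod M) → ℝ → Matrix (Finset (Orb Λ)) (Finset (Orb Λ)) ℂ := fun _ M _ _ _ _ _ e θ => ∑ b : ZMod M, ∑ σ : Fin 2, ((1 - Complex.exp (Complex.I * θ)) • (creation (orb (e.symm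 (0, b)) σ) * annihilation (orb (e.symm (-1, b)) σ)) + (1 - Complex.exp (-(Complex.I * θ))) • (creation (orb (e.symm (-1, b)) σ) * annihilation (orb (e.symm (0, b)) σ))); let Np : ℕ → ℕ → ℝ → ℕ := fun L M δ => 2 * ⌊(1 - δ) * ((L : ℝ) * (M : ℝ)) / 2⌋₊; let Hs : ∀ (L M : ℕ) [NeZero M] (Λ : Type) [LinearOrder Λ] [Fintype Λ], (Λ ≃ ZMod L × ZMod M) → ℕ → ℝ → Matrix (Finset (Orb Λ)) (Finset (Orb Λ)) ℂ := fun _ M _ Λ _ _ e M' U => hamiltonian (SimpleGraph.fromRel fun x y : Λ => y = e.symm ((e x).1 + 1, (e x).2) ∨ (((e x).2.val + 1 ≠ M' ∧ (e x).2.val + 1 ≠ M) ∧ y = e.symm ((e x).1, (e x).2 + 1)) ∨ ((e x).2.val + 1 = M' ∧ y = e.symm ((e x).1, 0)) ∨ ((e x).2.val + 1 = M ∧ y = e.symm ((e x).1, ((M' : ℕ) : ZMod M)))) 1 U; ∀ (L M : ℕ) [NeZero L] [NeZero M] (Λ : Type) [LinearOrder Λ] [Fintype Λ] (e : Λ ≃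 ZMod L × ZMod M) (M' : ℕ) (U θ : ℝ) (N : ℕ), (Hs L M Λ e M' U + Tw L M Λ e θ).IsHermitian ∧ (H0 L M Λ e U - Hs L M Λ e M' U).IsHermitian ∧ (∀ v : Fock (Orb Λ), v ∈ szSector N 0 → (Hs L M Λ e M' U + Tw L M Λ e θ) *ᵥ v ∈ szSector N 0) ∧ (∀ v : Fock (Orb Λ), v ∈ szSector N 0 → (H0 L M Λ e U - Hs L M Λ e M' U) *ᵥ v ∈ szSector N 0) ∧ (∀ δ ∈ Set.Ioo (0 : ℝ) (3 / 10), (szSector (Np L M δ) 0 : Submodule ℂ (Fock (Orb Λ))) ≠ ⊥) := by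
  dsimp only
  intro L M iL iM Λ _ _ e M' U θ N
  refine ⟨?_, ?_, ?_, ?_, ?_⟩
  · exact (LiebThm1.hamiltonian_isHermitian _ 1 U).add
      (isHermitian_twistSum (fun b σ => orb (e.symm (0, b)) σ) (fun b σ => orb (e.symm (-1, b)) σ) θ)
  · exact (LiebThm1.hamiltonian_isHermitian _ 1 U).sub (LiebThm1.hamiltonian_isHermitian _ 1 U)
  · intro v hv
    exact preservesSectors_mulVec_mem_szSector ((LiebThm1.preservesSectors_hamiltonian _ 1 U).add
      (preservesSectors_twistSum (fun b _ => e.symm (0, b)) (fun b _ => e.symm (-1, b))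
        (fun _ σ => σ) _ _)) hv
  · intro v hv
    exact preservesSectors_mulVec_mem_szSector (preservesSectors_sub
      (LiebThm1.preservesSectors_hamiltonian _ 1 U)
      (LiebThm1.preservesSectors_hamiltonian _ 1 U)) hv
  · intro δ hδ
    refine szSector_two_mul_zero_ne_bot ?_
    rw [card_eq_of_equiv_zmod_prod e]
    exact floor_filling_le hδ.1.le (by linarith [hδ.2])

/-- **Sector ground states of the seam-flow pencil exist** (the existence half of the witnesses of
`SeamFlow.StubSeamTwistResponse` / the data of `seamFlow_comparison`): for every partial seam
coupling `t`, twist `θ` and `δ ∈ (0, 3/10)` the pencil `Hs + Tw θ + t·(H0 - Hs)` (Hermitian,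
conserving `N↑`, `N↓`) has a unit vector of the nominal sector `szSector (2⌊(1-δ)LM/2⌋) 0`
realising its sector energy (`exists_unit_ground_szSector`). Same let-prefix as
`seamFlow_regularity`. Tasaki (2020) §2.2. [folklore] -/
theorem seamFlow_exists_unit_ground_pencil :
    open Matrix Literature.MathematicalPhysics.QuantumLattice in let H0 : ∀ (L M : ℕ) (Λ : Type) [LinearOrder Λ] [Fintype Λ], (Λ ≃ ZMod L × ZMod M) → ℝ → Matrix (Finset (Orb Λ)) (Finset (Orb Λ)) ℂ := fun _ _ Λ _ _ e U => hamiltonian (SimpleGraph.fromRel fun x y : Λ => y = e.symm ((e x).1 + 1, (e x).2) ∨ y = e.symm ((e x).1, (e x).2 + 1)) 1 U; let Tw : ∀ (L M : ℕ) [NeZero L] [NeZero M] (Λ : Type) [LinearOrder Λ] [Fintype Λ], (Λ ≃ ZMod L × ZMod M) → ℝ → Matrix (Finset (Orb Λ)) (Finset (Orb Λ)) ℂ := fun _ M _ _ _ _ _ e θ => ∑ b : ZMod M, ∑ σ : Fin 2, ((1 - Complex.exp (Complex.I * θ)) • (creation (orb (e.symm (0, b)) σ) * annihilation (orb (e.symm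 (-1, b)) σ)) + (1 - Complex.exp (-(Complex.I * θ))) • (creation (orb (e.symm (-1, b)) σ) * annihilation (orb (e.symm (0, b)) σ))); let Np : ℕ → ℕ → ℝ → ℕ := fun L M δ => 2 * ⌊(1 - δ) * ((L : ℝ) * (M : ℝ)) / 2⌋₊; let Hs : ∀ (L M : ℕ) [NeZero M] (Λ : Type) [LinearOrder Λ] [Fintype Λ], (Λ ≃ ZMod L × ZMod M) → ℕ → ℝ → Matrix (Finset (Orb Λ)) (Finset (Orb Λ)) ℂ := fun _ M _ Λ _ _ e M' U => hamiltonian (SimpleGraph.fromRel fun x y : Λ => y = e.symm ((e x).1 + 1, (e x).2) ∨ (((e x).2.val + 1 ≠ M' ∧ (e x).2.val + 1 ≠ M) ∧ y = e.symm ((e x).1, (e x).2 + 1)) ∨ ((e x).2.val + 1 = M' ∧ y = e.symm ((e x).1, 0)) ∨ ((e x).2.val + 1 = M ∧ y = e.symm ((e x).1, ((M' : ℕ) : ZMod M)))) 1 U; ∀ (L M : ℕ) [NeZero L] [NeZero M] (Λ : Type) [LinearOrder Λ] [Fintype Λ] (e : Λ ≃ ZMod L × ZMod M) (M' : ℕ)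 (U θ t : ℝ), ∀ δ ∈ Set.Ioo (0 : ℝ) (3 / 10), ∃ φ : Fock (Orb Λ), φ ∈ szSector (Np L M δ) 0 ∧ star φ ⬝ᵥ φ = 1 ∧ (star φ ⬝ᵥ (Hs L M Λ e M' U + Tw L M Λ e θ + (t : ℂ) • (H0 L M Λ e U - Hs L M Λ e M' U)) *ᵥ φ).re = (Hs L M Λ e M' U + Tw L M Λ e θ + (t : ℂ) • (H0 L M Λ e U - Hs L M Λ e M' U)).minEnergyOn (szSector (Np L M δ) 0) := by
  dsimp only
  intro L M iL iM Λ _ _ e M' U θ t δ hδ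
  have hH0 := LiebThm1.hamiltonian_isHermitian
    (SimpleGraph.fromRel fun x y : Λ => y = e.symm ((e x).1 + 1, (e x).2) ∨
      y = e.symm ((e x).1, (e x).2 + 1)) 1 U
  have hP0 := LiebThm1.preservesSectors_hamiltonian
    (SimpleGraph.fromRel fun x y : Λ => y = e.symm ((e x).1 + 1, (e x).2) ∨
      y = e.symm ((e x).1, (e x).2 + 1)) 1 U
  have hHs := LiebThm1.hamiltonian_isHermitian
    (SimpleGraph.fromRel fun x y : Λ => y = e.symm ((e x).1 + 1, (e x).2) ∨
      (((e x).2.val + 1 ≠ M' ∧ (e x).2.val + 1 ≠ M) ∧ y = e.symm ((e x).1, (e x).2 + 1)) ∨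
      ((e x).2.val + 1 = M' ∧ y = e.symm ((e x).1, 0)) ∨
      ((e x).2.val + 1 = M ∧ y = e.symm ((e x).1, ((M' : ℕ) : ZMod M)))) 1 U
  have hPs := LiebThm1.preservesSectors_hamiltonian
    (SimpleGraph.fromRel fun x y : Λ => y = e.symm ((e x).1 + 1, (e x).2) ∨
      (((e x).2.val + 1 ≠ M' ∧ (e x).2.val + 1 ≠ M) ∧ y = e.symm ((e x).1, (e x).2 + 1)) ∨
      ((e x).2.val + 1 = M' ∧ y = e.symm ((e x).1, 0)) ∨
      ((e x).2.val + 1 = M ∧ y = e.symm ((e x).1, ((M' : ℕ) : ZMod M)))) 1 U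
  have hTw := isHermitian_twistSum (Λ := Λ) (fun b σ => orb (e.symm (0, b)) σ)
    (fun b σ => orb (e.symm (-1, b)) σ) θ
  have hPTw := preservesSectors_twistSum (Λ := Λ) (fun b _ => e.symm (0, b)) (fun b _ => e.symm (-1, b))
    (fun _ σ => σ) (1 - Complex.exp (Complex.I * θ)) (1 - Complex.exp (-(Complex.I * θ)))
  refine exists_unit_ground_szSector (isHermitian_seamPencil hH0 hHs hTw t)
    (((hPs.add hPTw).add ((preservesSectors_sub hP0 hPs).smul _))) ?_
  rw [card_eq_of_equiv_zmod_prod e]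
  exact floor_filling_le hδ.1.le (by linarith [hδ.2])

end Summit.HubbardSuperconductivity.HubbardSuperconductivity.Theorems
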